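import Summits.BirchSwinnertonDyer.BirchSwinnertonDyer.Theorems.PrintCf2SplitBadTwoCMPrimaryDyadicUnramifiedSqrt
import HarnessLib

/-!
# Crux `PrintCf2.SplitBadTwoRankOneOfFacts` (stmt-BirchSwinnertonDyer-20368), road α v10.3 — brick B15 file 6: THE DYADIC TABLE AT THE RELAXED
# PLACE — `#W*(K_v) = 2` for EVERY member; the (U)-type mover and the (R)-type fixer (inputs of file 7: `#W*(K_{v̄}) = 4` for `d ≡ 3 (8)`)

Cell `bsd-print-cf2`, width seat `bsd-line-cf2-p1-w2` g9 (prover-bsd-line-cf2-p1-w2-g9-0); brick B15 (memo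
`Cruxes/SplitBadTwoRankOneOfFacts/B15-DYADIC-EXACT-w2g9.md` §3, row (1,3)); `--supports stmt-BirchSwinnertonDyer-20368` (helper, Theses-free). HONEST
FRAMING: nothing here closes the crux or a registered stub; BSD is not proved by any of this; no summit statement is proved by this seat. No definition,
no named fact, no `sorry`. Sequel of files 3–5 (`…CMPrimaryDyadicValue`, `…DyadicValueFrame`, `…DyadicUnramifiedSqrt`).

WHAT. The S3c₂/S3c frame: `C • W = cm7^{(d)}` (`d ≠ 0` squarefree, `d ≢ 1 (4)`), `K` imaginary quadratic, `v̄ ≠ v` the places above `2`, `π² = π − 2` in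
`End_K(E_K)`, `r² = r − 2`, pinning clause at `v` for `W* := E[𝔮_r^∞]` (unramified-twist type (U) at `v`, kernel type (R) at `v̄`; p657782, p654457).
* §1 `smul_eq_neg_of_unramifiedType` (the (U)-type MOVER: a `σ` of degree `n` with sign `s` on `ι√d` and `s·(−1)ⁿ = −1` acts as `−1` on `C[4]`),
  `smul_eq_of_kernelType` (the (R)-type FIXER: `s·e = (−1)ⁿ` ⇒ acts as `+1` on `C'[4]`), `two_not_mem_span_four`,
  `smul_geomSqrt_neg_one_eq_neg_of_cyclotomicCharacter` (`ε(g) = −1 ⇒ g • ζ₄ = −ζ₄`), `smul_absClosureEmbedding_geomSqrt_of_smul_geomSqrt` (sign transport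
  `√d ∈ ℚ̄ ↦ √d ∈ K̄`).
* §2 **`natCard_fixedPoints_decomp_v_eq_two_of_frame`** — `#W*(K_v) = #H⁰(K_v, W*) = 2` for EVERY member: mover at `v` = a dyadic Kummer inertia element
  negating `√d` (`d` even) or an inertia element with `ε = −1` (`d ≡ 3 (4)`; it negates `ζ₄` and fixes `√(−d)` by file 5, so it negates `√d`).
* File 7 (sequel) uses the fixer for `#W*(K_{v̄}) = 4` when `d ≡ 3 (mod 8)` (every `δ ∈ D_{v̄}` fixes `W*[4]`: inertia has sign `+1` on `√(−d)`, a
  degree-`1` element sign `−1`, file 5; `D_{v̄}` is generated by them, p658559). With file 4 the dyadic local factors of Agboola §6 / Prop. 8.1 on the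
  class become EXACT functions of `[d]₂`: `#W*(K_v) = 2` always; `#W*(K_{v̄}) = 4` iff `d ≡ 3 (8)`, else `2`. presearch: Rubin LNM 1716 §3 Lemma 3.6 (ii), Cor. 3.17; Agboola 2007 §6 / Prop. 8.1;
Neukirch II (7.13) — held; no fact filed. beyond-print theorem: no.

References: [Rubin1999] §3 Lemma 3.6 (ii), Cor. 3.17; [Agboola2007] §6, Prop. 8.1; [NeukirchANT1999] Ch. II (7.13), (9.6).
-/

noncomputable section

open scoped Classical

set_option linter.dupNamespace false
set_option autoImplicit false

namespace Summit.BirchSwinnertonDyer.BirchSwinnertonDyer.Theorems.PrintCf2.CMPrimes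

open WeierstrassCurve Literature.NumberTheory.EllipticCurves Literature.NumberTheory.GaloisRepresentations Field NumberField
  IsDedekindDomain
open Summit.BirchSwinnertonDyer.BirchSwinnertonDyer.Theorems.PrintCf2.AdditiveAtSeven
open Summit.BirchSwinnertonDyer.BirchSwinnertonDyer.Theorems.PrintCf2.ReductionTypesOverK
open Summit.BirchSwinnertonDyer.BirchSwinnertonDyer.Theorems.PrintCf2.RestrictedSelmerPair
open Summit.BirchSwinnertonDyer.BirchSwinnertonDyer.Theorems.GenusKolyTwistRamified (exists_mem_absInertia_smul_geomSqrt_eq_neg)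

/-! ## §1. The (U)-type mover, the (R)-type fixer, and small local inputs -/

section Movers

variable (K : Type) [Field K] [NumberField K] (W : WeierstrassCurve ℚ)

/-- `2 ∉ 4ℤ₂`. [folklore] -/
theorem two_not_mem_span_four : (2 : ℤ_[2]) ∉ (Ideal.span {(2 : ℤ_[2]) ^ 2} : Ideal ℤ_[2]) := by
  haveI : Fact (Nat.Prime 2) := ⟨Nat.prime_two⟩
  rw [show (2 : ℤ_[2]) ^ 2 = ((2 : ℕ) : ℤ_[2]) ^ 2 by norm_cast, ← PadicInt.ker_toZModPow, RingHom.mem_ker, map_ofNat]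
  decide

/-- **`ε(g) = −1 ⇒ g • ζ₄ = −ζ₄`** (`ζ₄ = ι√(−1)`): otherwise `ε(g) ≡ 1 (mod 4)` (file 3) and `2 ∈ 4ℤ₂`. [cite: SerreAbelianLadic1968, Ch. I §1.2] -/
theorem smul_geomSqrt_neg_one_eq_neg_of_cyclotomicCharacter (g : absoluteGaloisGroup K)
    (hε : ((GaloisRep.cyclotomicCharacter K 2 g : ℤ_[2]ˣ) : ℤ_[2]) = -1) :
    g • absClosureEmbedding ℚ K (WeierstrassCurve.geomSqrt (-1 : ℚ)) = -absClosureEmbedding ℚ K (WeierstrassCurve.geomSqrt (-1 : ℚ)) := by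
  rcases smul_absClosureEmbedding_geomSqrt_eq_or K (-1 : ℚ) g with h | h
  · exfalso
    have hmem := (cyclotomicCharacter_mem_span_four_of_smul_geomSqrt_neg_one K g).1 h
    rw [hε, show (-1 : ℤ_[2]) - 1 = -2 by ring, Ideal.neg_mem_iff] at hmem
    exact two_not_mem_span_four hmem
  · exact h

/-- Sign transport `√d ∈ ℚ̄ ↦ √d ∈ K̄`: if `g` negates `geomSqrt (d : K)` then it negates `ι(geomSqrt (d : ℚ))` (both square to `d`). [folklore] -/
theorem smul_absClosureEmbedding_geomSqrt_of_smul_geomSqrt {d : ℤ} (g : absoluteGaloisGroup K)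
    (h : g • WeierstrassCurve.geomSqrt ((d : ℤ) : K) = -WeierstrassCurve.geomSqrt ((d : ℤ) : K)) :
    g • absClosureEmbedding ℚ K (WeierstrassCurve.geomSqrt (d : ℚ)) = -absClosureEmbedding ℚ K (WeierstrassCurve.geomSqrt (d : ℚ)) := by
  set A := absClosureEmbedding ℚ K (WeierstrassCurve.geomSqrt (d : ℚ)) with hA
  set B := WeierstrassCurve.geomSqrt ((d : ℤ) : K) with hB
  have hsq : A ^ 2 = B ^ 2 := by
    rw [hA, hB, ← map_pow, WeierstrassCurve.geomSqrt_sq, WeierstrassCurve.geomSqrt_sq, AlgHom.commutes]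
    simp only [map_intCast]
  rcases sq_eq_sq_iff_eq_or_eq_neg.mp hsq with hAB | hAB
  · rw [hAB, h]
  · rw [hAB, smul_neg, h, neg_neg]

/-- **The (U)-type MOVER.** `C` carries the UNRAMIFIED-TWIST clause (U) of p657782 at `𝔭`: `res σ` of degree `n` with sign `s` on `ι√d` acts on `C[2^k]` as any
`N ≡ s·αⁿ`. If `s·(−1)ⁿ = −1` then `res σ` acts as `−1` on `C[4]` (`α ≡ −1 (mod 4)`). [cite: Rubin1999, §3 Lemma 3.6 (ii) and Cor. 3.17] -/
theorem smul_eq_neg_of_unramifiedType {𝔭 : HeightOneSpectrum (𝓞 K)} {C : AddSubgroup ((W.baseChange K).geomPrimaryTorsion 2)}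
    {α : ℤ_[2]ˣ} (hα : (α : ℤ_[2]) ^ 2 = (α : ℤ_[2]) - 2) {d : ℚ}
    (HU : ∀ (σ : absoluteGaloisGroup (𝔭.adicCompletion K)) (n : ℕ), IsFrobPow σ (n : ℤ) →
        ∀ s : ℤ,
          ((absGaloisRestrict K (𝔭.adicCompletion K) σ • absClosureEmbedding ℚ K (WeierstrassCurve.geomSqrt d) =
              absClosureEmbedding ℚ K (WeierstrassCurve.geomSqrt d) ∧ s = 1) ∨
           (absGaloisRestrict K (𝔭.adicCompletion K) σ • absClosureEmbedding ℚ K (WeierstrassCurve.geomSqrt d) =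
              -absClosureEmbedding ℚ K (WeierstrassCurve.geomSqrt d) ∧ s = -1)) →
          ∀ (k : ℕ), ∀ x ∈ C, 2 ^ k • x = 0 →
            ∀ N : ℤ, ((N : ℤ_[2]) - s * ((α ^ n : ℤ_[2]ˣ) : ℤ_[2])) ∈ (Ideal.span {(2 : ℤ_[2]) ^ k} : Ideal ℤ_[2]) →
              absGaloisRestrict K (𝔭.adicCompletion K) σ • x = N • x)
    {σ : absoluteGaloisGroup (𝔭.adicCompletion K)} {n : ℕ} (hσ : IsFrobPow σ (n : ℤ)) {s : ℤ}
    (hs : (absGaloisRestrict K (𝔭.adicCompletion K) σ • absClosureEmbedding ℚ K (WeierstrassCurve.geomSqrt d) =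
              absClosureEmbedding ℚ K (WeierstrassCurve.geomSqrt d) ∧ s = 1) ∨
           (absGaloisRestrict K (𝔭.adicCompletion K) σ • absClosureEmbedding ℚ K (WeierstrassCurve.geomSqrt d) =
              -absClosureEmbedding ℚ K (WeierstrassCurve.geomSqrt d) ∧ s = -1))
    (hsn : s * (-1) ^ n = -1) {x : (W.baseChange K).geomPrimaryTorsion 2} (hx : x ∈ C) (hx4 : 4 • x = 0) :
    absGaloisRestrict K (𝔭.adicCompletion K) σ • x = -x := by
  haveI : Fact (Nat.Prime 2) := ⟨Nat.prime_two⟩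
  have hα4 := (toZModPow_two_unitRoot hα).1
  have hmem : (((-1 : ℤ) : ℤ_[2]) - s * ((α ^ n : ℤ_[2]ˣ) : ℤ_[2])) ∈ (Ideal.span {(2 : ℤ_[2]) ^ 2} : Ideal ℤ_[2]) := by
    rw [show (2 : ℤ_[2]) = ((2 : ℕ) : ℤ_[2]) by norm_cast, ← PadicInt.ker_toZModPow, RingHom.mem_ker]
    rw [map_sub, map_mul, map_intCast, map_intCast, Units.val_pow_eq_pow_val, map_pow, hα4]
    have hsn' : (s : ZMod (2 ^ 2)) * (-1) ^ n = -1 := by exact_mod_cast congrArg (Int.cast : ℤ → ZMod (2 ^ 2)) hsn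
    rw [hsn', Int.cast_neg, Int.cast_one, sub_self]
  have h := HU σ n hσ s hs 2 x hx (by simpa using hx4) (-1) hmem
  rwa [neg_one_zsmul] at h

/-- **The (R)-type FIXER.** `C'` carries the kernel-type clause (R) at `𝔭`; a `σ` of degree `n` with signs `s` on `ι√d`, `e` on `ζ₄` and `s·e = (−1)ⁿ` — i.e.
`res σ` acts on `√(−d)` by `(−1)ⁿ` — acts TRIVIALLY on `C'[4]` (`s·ε·α^{−n} ≡ s·e·(−1)ⁿ = 1 (mod 4)`). [cite: Rubin1999, §3 Lemma 3.6 (ii) and Cor. 3.17] -/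
theorem smul_eq_of_kernelType {𝔭 : HeightOneSpectrum (𝓞 K)} {C' : AddSubgroup ((W.baseChange K).geomPrimaryTorsion 2)}
    {α : ℤ_[2]ˣ} (hα : (α : ℤ_[2]) ^ 2 = (α : ℤ_[2]) - 2) {d : ℚ}
    (HR : ∀ (σ : absoluteGaloisGroup (𝔭.adicCompletion K)) (n : ℕ), IsFrobPow σ (n : ℤ) →
        ∀ s : ℤ,
          ((absGaloisRestrict K (𝔭.adicCompletion K) σ • absClosureEmbedding ℚ K (WeierstrassCurve.geomSqrt d) =
              absClosureEmbedding ℚ K (WeierstrassCurve.geomSqrt d) ∧ s = 1) ∨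
           (absGaloisRestrict K (𝔭.adicCompletion K) σ • absClosureEmbedding ℚ K (WeierstrassCurve.geomSqrt d) =
              -absClosureEmbedding ℚ K (WeierstrassCurve.geomSqrt d) ∧ s = -1)) →
          ∀ (k : ℕ), ∀ x ∈ C', 2 ^ k • x = 0 →
            ∀ N : ℤ, ((N : ℤ_[2]) - s *
                ((GaloisRep.cyclotomicCharacter K 2 (absGaloisRestrict K (𝔭.adicCompletion K) σ) * (α⁻¹) ^ n :
                  ℤ_[2]ˣ) : ℤ_[2])) ∈ (Ideal.span {(2 : ℤ_[2]) ^ k} : Ideal ℤ_[2]) →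
              absGaloisRestrict K (𝔭.adicCompletion K) σ • x = N • x)
    {σ : absoluteGaloisGroup (𝔭.adicCompletion K)} {n : ℕ} (hσ : IsFrobPow σ (n : ℤ)) {s e : ℤ}
    (hs : (absGaloisRestrict K (𝔭.adicCompletion K) σ • absClosureEmbedding ℚ K (WeierstrassCurve.geomSqrt d) =
              absClosureEmbedding ℚ K (WeierstrassCurve.geomSqrt d) ∧ s = 1) ∨
           (absGaloisRestrict K (𝔭.adicCompletion K) σ • absClosureEmbedding ℚ K (WeierstrassCurve.geomSqrt d) =
              -absClosureEmbedding ℚ K (WeierstrassCurve.geomSqrt d) ∧ s = -1))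
    (he : (absGaloisRestrict K (𝔭.adicCompletion K) σ • absClosureEmbedding ℚ K (WeierstrassCurve.geomSqrt (-1 : ℚ)) =
              absClosureEmbedding ℚ K (WeierstrassCurve.geomSqrt (-1 : ℚ)) ∧ e = 1) ∨
           (absGaloisRestrict K (𝔭.adicCompletion K) σ • absClosureEmbedding ℚ K (WeierstrassCurve.geomSqrt (-1 : ℚ)) =
              -absClosureEmbedding ℚ K (WeierstrassCurve.geomSqrt (-1 : ℚ)) ∧ e = -1))
    (hse : s * e = (-1) ^ n) {x : (W.baseChange K).geomPrimaryTorsion 2} (hx : x ∈ C') (hx4 : 4 • x = 0) :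
    absGaloisRestrict K (𝔭.adicCompletion K) σ • x = x := by
  haveI : Fact (Nat.Prime 2) := ⟨Nat.prime_two⟩
  set g := absGaloisRestrict K (𝔭.adicCompletion K) σ with hg_def
  set ε := GaloisRep.cyclotomicCharacter K 2 g with hε_def
  have hεe : PadicInt.toZModPow 2 ((ε : ℤ_[2]ˣ) : ℤ_[2]) = (e : ZMod (2 ^ 2)) := by
    have h2 : (2 : ℤ_[2]) = ((2 : ℕ) : ℤ_[2]) := by norm_cast
    obtain ⟨hZ, rfl⟩ | ⟨hZ, rfl⟩ := he
    · have h := (cyclotomicCharacter_mem_span_four_of_smul_geomSqrt_neg_one K g).1 hZ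
      rw [h2, ← PadicInt.ker_toZModPow, RingHom.mem_ker, map_sub, map_one, sub_eq_zero] at h
      rw [h, Int.cast_one]
    · have h := (cyclotomicCharacter_mem_span_four_of_smul_geomSqrt_neg_one K g).2 hZ
      rw [h2, ← PadicInt.ker_toZModPow, RingHom.mem_ker, map_add, map_one] at h
      rw [Int.cast_neg, Int.cast_one, eq_neg_iff_add_eq_zero, h]
  have hαinv := (toZModPow_two_unitRoot hα).2
  have hmem : (((1 : ℤ) : ℤ_[2]) - s * ((ε * (α⁻¹) ^ n : ℤ_[2]ˣ) : ℤ_[2])) ∈ (Ideal.span {(2 : ℤ_[2]) ^ 2} : Ideal ℤ_[2]) := by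
    rw [show (2 : ℤ_[2]) = ((2 : ℕ) : ℤ_[2]) by norm_cast, ← PadicInt.ker_toZModPow, RingHom.mem_ker]
    rw [map_sub, map_mul, map_intCast, map_intCast, Units.val_mul, Units.val_pow_eq_pow_val, map_mul, map_pow, hεe, hαinv]
    have hse' : ((s : ZMod (2 ^ 2)) * e) = (-1) ^ n := by exact_mod_cast congrArg (Int.cast : ℤ → ZMod (2 ^ 2)) hse
    rw [show ((s : ZMod (2 ^ 2)) * ((e : ZMod (2 ^ 2)) * (-1) ^ n)) = ((s : ZMod (2 ^ 2)) * e) * (-1) ^ n by ring, hse', ← pow_add,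
      Even.neg_one_pow ⟨n, rfl⟩, Int.cast_one, sub_self]
  have h := HR σ n hσ s hs 2 x hx (by simpa using hx4) 1 hmem
  rwa [one_zsmul] at h

end Movers

/-! ## §2. `#W*(K_v) = 2` for every member (the relaxed place) -/

section Frame

variable {K : Type} [Field K] [NumberField K]

/-- **`#W*(K_v) = #H⁰(K_v, E[𝔮_r^∞]) = 2` FOR EVERY MEMBER OF THE CLASS** (S3c frame: `C • W = cm7^{(d)}`, `d ≠ 0` squarefree, `d ≢ 1 (4)`, `K` imaginary
quadratic, `v̄ ≠ v` above `2`, `π² = π − 2`, `r² = r − 2`, pinning clause at `v`): a mover of `W*[4]` in `D_v` exists — for `d` even a dyadic Kummer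
inertia element negating `√d`; for `d ≡ 3 (4)` an inertia element with `ε = −1` (it negates `ζ₄`, fixes `√(−d)` by file 5, hence negates `√d`).
[cite: Agboola2007, §6 and Prop. 8.1] [cite: Rubin1999, §3 Lemma 3.6 (ii) and Cor. 3.17] -/
theorem natCard_fixedPoints_decomp_v_eq_two_of_frame {d : ℤ} (hd0 : d ≠ 0) (hsq : Squarefree d) (hd4 : d % 4 ≠ 1)
    (W : WeierstrassCurve ℚ) [W.IsElliptic] (C : VariableChange ℚ) (hC : C • W = cm7.quadraticTwist (d : ℚ)) (hK : IsImaginaryQuadratic K)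
    (v vbar : HeightOneSpectrum (𝓞 K)) (hv : ((2 : ℕ) : 𝓞 K) ∈ v.asIdeal) (hvbar : ((2 : ℕ) : 𝓞 K) ∈ vbar.asIdeal) (hne : vbar ≠ v)
    (π : (W.baseChange K).endRing) (hrel : (π : AddMonoid.End (W.baseChange K).geomPoints) * π = π - 2) {r : ℤ_[2]} (hr : r * r = r - 2)
    (hclause : ∀ τ ∈ GreenbergSelmer.inertia v, ∀ x : ↥((W.baseChange K).endEigenPrimaryTorsion 2 π r), τ • x = x ∨ τ • x = -x) :
    Nat.card (FixedPoints.addSubgroup (GreenbergSelmer.decomp v) ↥((W.baseChange K).endEigenPrimaryTorsion 2 π r)) = 2 := by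
  haveI : Fact (Nat.Prime 2) := ⟨Nat.prime_two⟩
  have hj : W.j = -3375 := j_eq_of_smul_eq_cm7Twist hd0 W C hC
  obtain ⟨θ, hθ⟩ := exists_sq_eq_neg_seven_of_cmEndo_mem_endRing W K hj π hrel
  have hK2 : Module.finrank ℚ K = 2 := hK.1
  obtain ⟨-, -, -, -, -, -, hgen, -⟩ := endEigenPrimaryTorsion_two_structure W hj K hθ π hrel hr
  obtain ⟨g, hg, hord, -⟩ := hgen 2
  have hg4 : 4 • g = 0 := by rw [show (4 : ℕ) = 2 ^ 2 from rfl, ← hord]; exact addOrderOf_nsmul_eq_zero g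
  have hg2 : 2 • g ≠ 0 := fun h ↦ by
    have hdvd : addOrderOf g ∣ 2 := addOrderOf_dvd_of_nsmul_eq_zero h
    rw [hord] at hdvd
    exact absurd (Nat.le_of_dvd two_pos hdvd) (by norm_num)
  -- the (U)-clause at `v` for `E[𝔮_r^∞]`
  have hcl : ∀ τ ∈ GreenbergSelmer.inertia v, ∀ x ∈ (W.baseChange K).endEigenPrimaryTorsion 2 π r, τ • x = x ∨ τ • x = -x :=
    fun τ hτ x hx ↦ by
      rcases hclause τ hτ ⟨x, hx⟩ with h | h
      · exact Or.inl (congrArg Subtype.val h)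
      · exact Or.inr (congrArg Subtype.val h)
  have hdQ : (d : ℚ) ≠ 0 := by exact_mod_cast hd0
  obtain ⟨α, hα, -, hUR⟩ := endEigenPrimaryTorsion_two_localTypes_named_of_pinned W K hj hθ π hrel hr hdQ C hC v hv
    (inertiaDeg_eq_one_of_ne_two K hK2 hv hvbar hne) hcl
  have HU := fun σ n hσ s hs ↦ (hUR σ n hσ s hs).1
  refine natCard_fixedPoints_decomp_eq_two_of_exists_smul_ne W K hj hK2 hθ π hrel hr hv hvbar hne ?_
  -- a mover at `v`
  by_cases h2d : 2 ∣ d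
  · -- `d` even: a Kummer inertia element negating `√d`
    obtain ⟨d', rfl⟩ := h2d
    have hd' : ¬ (2 : ℤ) ∣ d' := by
      rintro ⟨k, rfl⟩
      have h := hsq 2 ⟨k, by ring⟩
      rw [Int.isUnit_iff] at h; omega
    set u := v.under (𝓞 ℚ) with hu
    have h2u : ((2 : ℕ) : 𝓞 ℚ) ∈ u.asIdeal := by
      change algebraMap (𝓞 ℚ) (𝓞 K) ((2 : ℕ) : 𝓞 ℚ) ∈ v.asIdeal
      rwa [map_natCast]
    have hgen2 : Rat.HeightOneSpectrum.natGenerator u = 2 :=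
      (Nat.prime_dvd_prime_iff_eq (Rat.HeightOneSpectrum.prime_natGenerator u) Nat.prime_two).mp ((Rat.natCast_mem_asIdeal_iff _).mp h2u)
    have he1 : v.asIdeal.ramificationIdx (𝓞 ℚ) = 1 := ramificationIdx_eq_one_of_frame K v hK hθ hd0 W hC (by rw [← hu, hgen2]; norm_num)
    have hval : v.valuation K (((2 * d' : ℤ)) : K) = WithZero.exp (-1 : ℤ) := by
      have hnd : ¬ ((Rat.HeightOneSpectrum.natGenerator u : ℕ) : ℤ) ∣ d' := by rw [hgen2]; exact hd'
      have h := Rat.valuation_pow_mul_intCast u hnd 1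
      rw [hgen2, pow_one] at h
      rw [show (((2 * d' : ℤ)) : K) = algebraMap ℚ K ((((2 : ℕ) : ℚ) * ((d' : ℤ) : ℚ))) by
          rw [map_mul, map_natCast, map_intCast]; push_cast; ring,
        valuation_algebraMap_eq_pow_ramificationIdx K v, he1, pow_one, ← hu]
      exact_mod_cast h
    obtain ⟨τ, hτI, hτB⟩ := exists_mem_absInertia_smul_geomSqrt_eq_neg (K := K) v (d := ((2 * d' : ℤ) : K))
      (by exact_mod_cast hd0) ⟨_, 1, hval, by ring⟩
    have hτ0 : IsFrobPow τ ((0 : ℕ) : ℤ) := by exact_mod_cast isFrobPow_zero_iff_mem_absInertia.mpr hτI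
    have hA := smul_absClosureEmbedding_geomSqrt_of_smul_geomSqrt K (d := 2 * d') _ hτB
    exact ⟨absGaloisRestrict K (v.adicCompletion K) τ, ⟨τ, rfl⟩, g, hg, hg4, fun h ↦ hg2 (by
      rw [smul_eq_neg_of_unramifiedType K W hα HU hτ0 (s := -1) (Or.inr ⟨by exact_mod_cast hA, rfl⟩) (by norm_num) hg hg4] at h
      rw [two_nsmul]; exact neg_eq_iff_add_eq_zero.mp h)⟩
  · -- `d ≡ 3 (mod 4)`: an inertia element with `ε = −1`
    have hd3 : (-d) % 4 = 1 := by omega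
    have hum1 : IsUnit ((-1 : ℤ) : ℤ_[2]) := by rw [Int.cast_neg, Int.cast_one]; exact isUnit_one.neg
    obtain ⟨τ, hτI, hτχ⟩ := ZpExtension.exists_mem_inertia_cyclotomicCharacter_eq_of_split hK2 hvbar hv hne.symm
      (adicCompletionPrime_mem_primesAbove K v) hum1.unit
    rw [inertia_adicCompletionPrime_eq_map_absInertia K v, Subgroup.mem_map] at hτI
    obtain ⟨σ, hσI, hστ⟩ := hτI
    have hε : ((GaloisRep.cyclotomicCharacter K 2 (absGaloisRestrict K (v.adicCompletion K) σ) : ℤ_[2]ˣ) : ℤ_[2]) = -1 := by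
      have := congrArg (fun u : ℤ_[2]ˣ ↦ (u : ℤ_[2])) hτχ
      simp only [IsUnit.unit_spec, Int.cast_neg, Int.cast_one] at this
      rw [← this]
      exact congrArg (fun g ↦ ((GaloisRep.cyclotomicCharacter K 2 g : ℤ_[2]ˣ) : ℤ_[2])) hστ
    have hZ := smul_geomSqrt_neg_one_eq_neg_of_cyclotomicCharacter K _ hε
    have hB := smul_geomSqrt_eq_of_mem_absInertia_of_emod_four_eq_one v hv hd3 hσI
    have hσ0 : IsFrobPow σ ((0 : ℕ) : ℤ) := by exact_mod_cast isFrobPow_zero_iff_mem_absInertia.mpr hσI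
    rcases smul_absClosureEmbedding_geomSqrt_eq_or K (d : ℚ) (absGaloisRestrict K (v.adicCompletion K) σ) with hA | hA
    · have hse := sign_mul_eq_of_smul_geomSqrt K hd0 _ (s := 1) (e := -1) (Or.inl ⟨hA, rfl⟩) (Or.inr ⟨hZ, rfl⟩) (Or.inl ⟨hB, rfl⟩)
      norm_num at hse
    · exact ⟨absGaloisRestrict K (v.adicCompletion K) σ, ⟨σ, rfl⟩, g, hg, hg4, fun h ↦ hg2 (by
        rw [smul_eq_neg_of_unramifiedType K W hα HU hσ0 (s := -1) (Or.inr ⟨hA, rfl⟩) (by norm_num) hg hg4] at h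
        rw [two_nsmul]; exact neg_eq_iff_add_eq_zero.mp h)⟩

end Frame

end Summit.BirchSwinnertonDyer.BirchSwinnertonDyer.Theorems.PrintCf2.CMPrimes

end
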